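import Summits.CriticalPhenomena.PercolationContinuityZ3.Theorems.SahiMasterFamilyZeroFlagMinorF
import Summits.CriticalPhenomena.PercolationContinuityZ3.Theorems.SahiMasterFamilyFIneqAllThirdEvents
import HarnessLib

/-!
# The 0-minor side: `MD₃` on the EXTENDED D0 core — the third member may depend on the glued coordinate

Unit `prim-master-conj` (crux anchor stmt-CriticalPhenomena-4575, helper work), gen 30; memo
`run/shared/lean/prim/prim-l12/prim-master-conj/POINTWISE.md` §31.  Sequel of gen 20's `…ZeroFlagMinorF` and of
`…FIneqAllThirdEvents` (THEOREM F, seat bnk-2 gen 21).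

SETTING.  An increasing triple `U`, a coordinate `e`, `0`-minor `P = U^{e←0} = (X, Y, G)` with trivial forced hull (`X ⊆ G`, `Y ⊆ G`,
`μ(X∩Y) = μX·μY`), `1`-minor `Q = U^{e←1} = (A, B, C) ⊇ P`.  Gen 20 treated the case `C = G` (third member `e`-free) and showed
`Λ := mixC2(P,Q) − E₃(Q) = F(A,B;G) + (nonnegative)`, so that THEOREM F gives `MD₃` there (`SahiFCombBridge.sahiE_three_ge_sq_minor`).
THIS FILE removes the hypothesis `C = G`:

* `mixC2_sub_sahiE_eq_F_add_general` — for ANY weight and any `P, Q` satisfying only the four `κ = 1` sandwich relations on `P`: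
  **`Λ = F(Q₀,Q₁;Q₂) + (m(Q₀Q₂) − p₀)(m(Q₁Q₂) − p₁) + (1 − q₂)·[m(Q₀Q₁Q₂) + p₀p₁ − p₀q₁ − p₁q₀] + (q₂ − p₂)·(m(Q₀Q₁) − q₀q₁)`**
  (pure algebra; at `Q₂ = P₂` the last term vanishes and this is gen 20's identity).
* `mixC2_sub_sahiE_ge_F_general` — for an increasing triple: every extra term is `≥ 0` (`X ⊆ A∩C`, `Y ⊆ B∩C`; the bracket dominates gen 20's
  bracket `μ((A∖X)(B∖Y)G) + Cov(X,B) + Cov(A,Y) ≥ 0` because `C ⊇ G`; `μC ≥ μG` and Harris for `Cov(A,B)`), hence **`Λ ≥ F(A,B;C)`**.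
* **`sahiE_three_ge_sq_mul_secAt_true_of_sandwich_zero_minor`** — with THEOREM F (`SahiFCombBridge.fIneq_nonneg` for `(A,B,C)`) and
  `E₃(U^{e←0}) = 0` (`sahiE_three_secAt_false_eq_zero_of_sandwich_zero_minor`):  **`p_e²·E₃(μ_p;U^{e←1}) ≤ E₃(μ_p;U)`** for EVERY increasing triple
  whose `0`-minor at `e` is a hull-`Ω` sandwich (`X, Y ⊆ G`, `X ⟂ Y` at `μ_p`) — no hypothesis at all on the `1`-minor (= `MD₃` at `(U,e)` on
  this class).  Hence `C₃` passes up from the `1`-minor (`sahiE_three_nonneg_of_sandwich_zero_minor`) and zeros pass down to it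
  (`sahiE_three_secAt_true_eq_zero_of_sandwich_zero_minor`, `p_e ≠ 0`).
HONEST FRAMING: an identity plus bookkeeping on top of THEOREM F; the general `0`-minor side (nontrivial forced hull `K ≠ Ω`) and `C₃` remain OPEN.
Numerics before formalisation: the identity and `Λ ≥ 0` checked in exact arithmetic on 400 random extended-core configurations, `n ≤ 5`
(code `prim-master-conj/code-g30/d0ext.py`). [this work]
-/

noncomputable section

open scoped Classical

namespace Summit.CriticalPhenomena.PercolationContinuityZ3.Theorems

open Finset Function
open Literature.Combinatorics.Sahi2008
open Literature.Probability.Percolation.DecisionTree (ind)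
open SahiCombMix

namespace Pointwise

variable {ι : Type} [Fintype ι]

/-! ### 1. The identity without `Q 2 = P 2` -/

section Identity

variable (μ : Set ι → ℝ) (P Q : Fin 3 → Set (Set ι))
  (h1 : ex μ (ind (P 0) * ind (P 1)) = ex μ (ind (P 0)) * ex μ (ind (P 1)))
  (h2 : ex μ (ind (P 0) * ind (P 2)) = ex μ (ind (P 0)))
  (h3 : ex μ (ind (P 1) * ind (P 2)) = ex μ (ind (P 1)))
  (h4 : ex μ (ind (P 0) * ind (P 1) * ind (P 2)) = ex μ (ind (P 0)) * ex μ (ind (P 1)))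
include h1 h2 h3 h4

/-- **`Λ = F(A,B;C) + (m(AC) − x)(m(BC) − y) + (1 − c)·[m(ABC) + xy − x·b − y·a] + (c − g)·(m(AB) − a·b)`** (file header;
`x = μP₀`, `y = μP₁`, `g = μP₂`, `a = μQ₀`, `b = μQ₁`, `c = μQ₂`).  Pure algebra from the four `κ = 1` sandwich relations on `P`;
no relation between `P₂` and `Q₂` is assumed. [this work] -/
theorem mixC2_sub_sahiE_eq_F_add_general :
    mixC2 μ P Q - sahiE μ 3 (fun j => ind (Q j))
      = ((1 + ex μ (ind (Q 2))) * ex μ (ind (Q 0) * ind (Q 1) * ind (Q 2))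
            - ex μ (ind (Q 2)) * ex μ (ind (Q 0) * ind (Q 1))
            - ex μ (ind (Q 0) * ind (Q 2)) * ex μ (ind (Q 1) * ind (Q 2)))
        + (ex μ (ind (Q 0) * ind (Q 2)) - ex μ (ind (P 0))) * (ex μ (ind (Q 1) * ind (Q 2)) - ex μ (ind (P 1)))
        + (1 - ex μ (ind (Q 2))) * (ex μ (ind (Q 0) * ind (Q 1) * ind (Q 2)) + ex μ (ind (P 0)) * ex μ (ind (P 1))
            - ex μ (ind (P 0)) * ex μ (ind (Q 1)) - ex μ (ind (P 1)) * ex μ (ind (Q 0)))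
        + (ex μ (ind (Q 2)) - ex μ (ind (P 2))) * (ex μ (ind (Q 0) * ind (Q 1)) - ex μ (ind (Q 0)) * ex μ (ind (Q 1))) := by
  rw [mixC2, sahiE_three_apply]
  linear_combination (-(ex μ (ind (Q 2)))) * h1 - ex μ (ind (Q 1)) * h2 - ex μ (ind (Q 0)) * h3 + 2 * h4

end Identity

/-! ### 2. The extended core for an increasing triple -/

section Core

variable (p : ι → unitInterval) (e : ι) (U : Fin 3 → Set (Set ι)) (hU : ∀ j, IsUpperSet (U j))
  (hXG : secAt e false (U 0) ⊆ secAt e false (U 2)) (hYG : secAt e false (U 1) ⊆ secAt e false (U 2))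
  (hXY : ex (bernoulliWeight p) (ind (secAt e false (U 0) ∩ secAt e false (U 1)))
    = ex (bernoulliWeight p) (ind (secAt e false (U 0))) * ex (bernoulliWeight p) (ind (secAt e false (U 1))))
include hU hXG hYG hXY

/-- **`Λ ≥ F(A,B;C)` on the extended D0 core** (`A, B, C` the `1`-sections; the `0`-minor `(X,Y,G)` has `X, Y ⊆ G` and `X ⟂ Y` at `μ_p`;
NOTHING assumed about `C` versus `G` beyond `G ⊆ C`, which holds for an increasing triple). [this work] -/
theorem mixC2_sub_sahiE_ge_F_general :
    (1 + ex (bernoulliWeight p) (ind (secAt e true (U 2))))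
          * ex (bernoulliWeight p) (ind (secAt e true (U 0) ∩ secAt e true (U 1) ∩ secAt e true (U 2)))
        - ex (bernoulliWeight p) (ind (secAt e true (U 2))) * ex (bernoulliWeight p) (ind (secAt e true (U 0) ∩ secAt e true (U 1)))
        - ex (bernoulliWeight p) (ind (secAt e true (U 0) ∩ secAt e true (U 2)))
          * ex (bernoulliWeight p) (ind (secAt e true (U 1) ∩ secAt e true (U 2)))
      ≤ mixC2 (bernoulliWeight p) (fun j => secAt e false (U j)) (fun j => secAt e true (U j))
          - sahiE (bernoulliWeight p) 3 (fun j => ind (secAt e true (U j))) := by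
  set m := bernoulliWeight p with hm
  set X := secAt e false (U 0); set Y := secAt e false (U 1); set G := secAt e false (U 2)
  set A := secAt e true (U 0); set B := secAt e true (U 1); set C := secAt e true (U 2)
  have hXu : IsUpperSet X := isUpperSet_secAt e false (hU 0)
  have hYu : IsUpperSet Y := isUpperSet_secAt e false (hU 1)
  have hAu : IsUpperSet A := isUpperSet_secAt e true (hU 0)
  have hBu : IsUpperSet B := isUpperSet_secAt e true (hU 1)
  have sA : X ⊆ A := RigidityAll.secAt_false_subset_secAt_true e (hU 0)
  have sB : Y ⊆ B := RigidityAll.secAt_false_subset_secAt_true e (hU 1)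
  have sC : G ⊆ C := RigidityAll.secAt_false_subset_secAt_true e (hU 2)
  -- the four `κ = 1` sandwich relations in product form
  have eXG : X ∩ G = X := Set.inter_eq_left.mpr hXG
  have eYG : Y ∩ G = Y := Set.inter_eq_left.mpr hYG
  have eXYG : X ∩ Y ∩ G = X ∩ Y := Set.inter_eq_left.mpr (fun ω hω => hXG hω.1)
  have h1 : ex m (ind X * ind Y) = ex m (ind X) * ex m (ind Y) := by rw [ind_mul_ind_eq_inter]; exact hXY
  have h2 : ex m (ind X * ind G) = ex m (ind X) := by rw [ind_mul_ind_eq_inter, eXG]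
  have h3 : ex m (ind Y * ind G) = ex m (ind Y) := by rw [ind_mul_ind_eq_inter, eYG]
  have h4 : ex m (ind X * ind Y * ind G) = ex m (ind X) * ex m (ind Y) := by
    rw [ind_mul_ind_eq_inter, ind_mul_ind_eq_inter, eXYG]; exact hXY
  have hId := mixC2_sub_sahiE_eq_F_add_general m (fun j => secAt e false (U j)) (fun j => secAt e true (U j)) h1 h2 h3 h4
  simp only [ind_mul_ind_eq_inter] at hId
  -- positivity of the three extra terms
  have tc : 0 ≤ 1 - ex m (ind C) := by rw [one_sub_ex_ind p C]; exact ex_ind_nonneg' p _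
  have tcell : 0 ≤ ex m (ind (G ∩ A ∩ B)) - ex m (ind (G ∩ A ∩ Y)) - ex m (ind (G ∩ X ∩ B)) + ex m (ind (G ∩ X ∩ Y)) := by
    rw [← cell_inter_sdiff_sdiff m G sA sB]; exact ex_ind_nonneg' p _
  have tXB : 0 ≤ ex m (ind (X ∩ B)) - ex m (ind X) * ex m (ind B) := cov_ind_nonneg p hXu hBu
  have tAY : 0 ≤ ex m (ind (A ∩ Y)) - ex m (ind A) * ex m (ind Y) := cov_ind_nonneg p hAu hYu
  have tAB : 0 ≤ ex m (ind (A ∩ B)) - ex m (ind A) * ex m (ind B) := cov_ind_nonneg p hAu hBu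
  have sAC : X ⊆ A ∩ C := fun ω hω => Set.mem_inter (sA hω) (sC (hXG hω))
  have sBC : Y ⊆ B ∩ C := fun ω hω => Set.mem_inter (sB hω) (sC (hYG hω))
  have tAC : 0 ≤ ex m (ind (A ∩ C)) - ex m (ind X) := by
    rw [ex_ind_sub_of_subset _ sAC]; exact ex_ind_nonneg' p _
  have tBC : 0 ≤ ex m (ind (B ∩ C)) - ex m (ind Y) := by
    rw [ex_ind_sub_of_subset _ sBC]; exact ex_ind_nonneg' p _
  have tprod := mul_nonneg tAC tBC
  have tCG : 0 ≤ ex m (ind C) - ex m (ind G) := by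
    rw [ex_ind_sub_of_subset _ sC]; exact ex_ind_nonneg' p _
  have tmono : 0 ≤ ex m (ind (A ∩ B ∩ C)) - ex m (ind (A ∩ B ∩ G)) := by
    have hsub : A ∩ B ∩ G ⊆ A ∩ B ∩ C := fun ω hω => ⟨hω.1, sC hω.2⟩
    rw [ex_ind_sub_of_subset _ hsub]; exact ex_ind_nonneg' p _
  -- set bookkeeping
  have e1 : G ∩ A ∩ B = A ∩ B ∩ G := by ac_rfl
  have e2 : G ∩ A ∩ Y = A ∩ Y := by
    rw [show G ∩ A ∩ Y = A ∩ (Y ∩ G) by ac_rfl, eYG]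
  have e3 : G ∩ X ∩ B = X ∩ B := by
    rw [show G ∩ X ∩ B = (X ∩ G) ∩ B by ac_rfl, eXG]
  have e4 : G ∩ X ∩ Y = X ∩ Y := by
    rw [show G ∩ X ∩ Y = X ∩ Y ∩ G by ac_rfl, eXYG]
  rw [e1, e2, e3, e4] at tcell
  have hXY' : ex m (ind (X ∩ Y)) = ex m (ind X) * ex m (ind Y) := hXY
  have tbr : 0 ≤ ex m (ind (A ∩ B ∩ C)) + ex m (ind X) * ex m (ind Y)
      - ex m (ind X) * ex m (ind B) - ex m (ind Y) * ex m (ind A) := by nlinarith [tcell, tXB, tAY, hXY', tmono]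
  have t2 := mul_nonneg tc tbr
  have t3 := mul_nonneg tCG tAB
  rw [hId]
  nlinarith [t2, tprod, t3]

omit hU in
/-- On the extended D0 core the `0`-minor itself has `E₃ = 0` at `μ_p` (the four sandwich relations). [this work] -/
theorem sahiE_three_secAt_false_eq_zero_of_sandwich_zero_minor :
    sahiE (bernoulliWeight p) 3 (fun j => ind (secAt e false (U j))) = 0 := by
  set m := bernoulliWeight p with hm
  set X := secAt e false (U 0); set Y := secAt e false (U 1); set G := secAt e false (U 2)
  have eXG : X ∩ G = X := Set.inter_eq_left.mpr hXG
  have eYG : Y ∩ G = Y := Set.inter_eq_left.mpr hYG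
  have eXYG : X ∩ Y ∩ G = X ∩ Y := Set.inter_eq_left.mpr (fun ω hω => hXG hω.1)
  have h1 : ex m (ind X * ind Y) = ex m (ind X) * ex m (ind Y) := by rw [ind_mul_ind_eq_inter]; exact hXY
  have h2 : ex m (ind X * ind G) = 1 * ex m (ind X) := by rw [ind_mul_ind_eq_inter, eXG, one_mul]
  have h3 : ex m (ind Y * ind G) = 1 * ex m (ind Y) := by rw [ind_mul_ind_eq_inter, eYG, one_mul]
  have h4 : ex m (ind X * ind Y * ind G) = 1 * ex m (ind X) * ex m (ind Y) := by
    rw [ind_mul_ind_eq_inter, ind_mul_ind_eq_inter, eXYG, one_mul]; exact hXY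
  exact sahiE_three_eq_zero_of_sandwich_moments m (fun j => secAt e false (U j)) 1 h1 h2 h3 h4

/-- **Domination by the `1`-minor on the extended D0 core (unconditional).**  For an increasing triple `U` whose `0`-minor `(X,Y,G)` at
`e` has `X ⊆ G`, `Y ⊆ G` and `μ_p(X∩Y) = μ_p(X)μ_p(Y)` — the `1`-minor being ARBITRARY (its third member may differ from `G`) —
**`p_e²·E₃(μ_p; U^{e←1}) ≤ E₃(μ_p; U)`**.  THEOREM F supplies `F(A,B;C) ≥ 0` for the `1`-sections; gen 20/21 had this only for an
`e`-free third member (`SahiFCombBridge.sahiE_three_ge_sq_minor`). [this work] -/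
theorem sahiE_three_ge_sq_mul_secAt_true_of_sandwich_zero_minor :
    (p e : ℝ) ^ 2 * sahiE (bernoulliWeight p) 3 (fun j => ind (secAt e true (U j)))
      ≤ sahiE (bernoulliWeight p) 3 (fun j => ind (U j)) := by
  have hmix : sahiE (bernoulliWeight p) 3 (fun j => ind (secAt e true (U j)))
      ≤ mixC2 (bernoulliWeight p) (fun j => secAt e false (U j)) (fun j => secAt e true (U j)) := by
    have h := mixC2_sub_sahiE_ge_F_general p e U hU hXG hYG hXY
    have hF := SahiFCombBridge.fIneq_nonneg p (secAt e true (U 0)) (secAt e true (U 1)) (secAt e true (U 2))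
      (isUpperSet_secAt e true (hU 0)) (isUpperSet_secAt e true (hU 1)) (isUpperSet_secAt e true (hU 2))
    linarith
  have htwo := sahiE_three_ge_sq_minors_of_mixC2_ge e U hU p hmix
  rw [sahiE_three_secAt_false_eq_zero_of_sandwich_zero_minor p e U hXG hYG hXY, mul_zero, zero_add] at htwo
  exact htwo

/-- **`C₃` passes from the `1`-minor to `U` on the extended D0 core**: `E₃(μ_p; U^{e←1}) ≥ 0 ⟹ E₃(μ_p; U) ≥ 0`. [this work] -/
theorem sahiE_three_nonneg_of_sandwich_zero_minor
    (h1 : 0 ≤ sahiE (bernoulliWeight p) 3 (fun j => ind (secAt e true (U j)))) :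
    0 ≤ sahiE (bernoulliWeight p) 3 (fun j => ind (U j)) :=
  le_trans (mul_nonneg (sq_nonneg _) h1) (sahiE_three_ge_sq_mul_secAt_true_of_sandwich_zero_minor p e U hU hXG hYG hXY)

/-- **Zeros pass down to the `1`-minor on the extended D0 core**: if `p_e ≠ 0`, `E₃(μ_p;U^{e←1}) ≥ 0` and `E₃(μ_p;U) = 0`, then
`E₃(μ_p;U^{e←1}) = 0` (the pointwise-`EQ₃` half of settledness transfer). [this work] -/
theorem sahiE_three_secAt_true_eq_zero_of_sandwich_zero_minor (hpe : (p e : ℝ) ≠ 0)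
    (h1 : 0 ≤ sahiE (bernoulliWeight p) 3 (fun j => ind (secAt e true (U j))))
    (h0 : sahiE (bernoulliWeight p) 3 (fun j => ind (U j)) = 0) :
    sahiE (bernoulliWeight p) 3 (fun j => ind (secAt e true (U j))) = 0 := by
  have h := sahiE_three_ge_sq_mul_secAt_true_of_sandwich_zero_minor p e U hU hXG hYG hXY
  rw [h0] at h
  have hsq : 0 < (p e : ℝ) ^ 2 := by positivity
  nlinarith [mul_nonneg (le_of_lt hsq) h1]

end Core

end Pointwise

end Summit.CriticalPhenomena.PercolationContinuityZ3.Theorems
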